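import Mathlib
import Summits.Ventures.HodgeRepro2.T5RecordSphericalSpectrum
import Summits.Ventures.HodgeRepro2.T5RecordSatakeDegreeIntrinsic

/-!
# THE UNRAMIFIED SPECTRUM OF THE RECORD'S OWN PAIR AT EVERY PLACE THAT STAYS PRIME

Tier-5 support N3 / §G-N4.2 (seat p3, gen 85). File 343 identified the `K_v`-spherical irreducible representations
of the record's pair `(U(1 ⊗ H), K_v)` with spherical subquotients of unramified principal series, under seat p8's
standing local hypotheses on the completions (`θ` a non-square in `K⁺_v`, `e(w/v) = 1`, `ϖ` inert). File 233's method
discharges every one of them from the single global hypothesis `v 𝓞_K = w`. Hence: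

* **`forall_nonempty_equiv_inertSphericalQuot_record_of_mulEquiv_of_eq`** — file 343's matched-isomorphism
  theorem with `N(v)` replaced by any `q'` equal to it (the form the numerals use);
* **`exists_mulEquiv_forall_nonempty_equiv_inertSphericalQuot_record_of_staysPrime`** — at every place `v` of
  `K⁺` with `v 𝓞_K = w`, good for `H`: `u₀ ∈ 𝒪_{K⁺_v}ˣ`, `Φ : U(J₃(u₀)) ≃* U(1 ⊗ H)` matching the hyperspecial
  subgroups, a uniformiser `ϖ'` of `𝒪_{E_v}` fixed by the star, such that every irreducible `K_v`-finite
  representation of `U(1 ⊗ H)` with non-zero finite-dimensional `K_v`-invariants is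
  `≅ (inertSphericalQuot (α q'⁻²)) ∘ Φ⁻¹` for some `α ≠ 0`, `q' = N(v)`;
  (the numeral instances — `ℚ(i)` at `(3)` with `q' = 3`, `ℚ(ζ₇)` at its inert places — are direct
  specialisations through files 238 / 249 / 257; not included here).

Nothing here is a statement about (P), theta lifts or L-values. §8(d): uses an L-value-free non-vanishing
device: NO.
-/

open Matrix NumberField NumberField.IsCMField IsDedekindDomain IsDedekindDomain.HeightOneSpectrum Module
  MulAction
open scoped TensorProduct Pointwise
open Summit.Ventures.HodgeRepro2.T5UnitaryGroupForm Summit.Ventures.HodgeRepro2.T5UnitaryHeckeAdjoint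
  Summit.Ventures.HodgeRepro2.T5HeckePermutationModule Summit.Ventures.HodgeRepro2.LevelPositivity
  Summit.Ventures.HodgeRepro2.T5LevelIdempotent Summit.Ventures.HodgeRepro2.T5StarOfInvolution
  Summit.Ventures.HodgeRepro2.T5FinitePlaceCM Summit.Ventures.HodgeRepro2.T5NonSplitPlaceUnitaryGroup
  Summit.Ventures.HodgeRepro2.T5RecordHyperspecial Summit.Ventures.HodgeRepro2.T5GlobalLatticeAlmostAll
  Summit.Ventures.HodgeRepro2.T5HermitianThreeElements Summit.Ventures.HodgeRepro2.T5GaloisCartanThree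
  Summit.Ventures.HodgeRepro2.T5InertDegreeGalois Summit.Ventures.HodgeRepro2.T5InertPlaceCompletion
  Summit.Ventures.HodgeRepro2.T5InertDegreeAdicCompletion Summit.Ventures.HodgeRepro2.T5InertSatakeTransform
  Summit.Ventures.HodgeRepro2.T5InertSatakeTransformCompletion Summit.Ventures.HodgeRepro2.T5InertUnipotentResidue
  Summit.Ventures.HodgeRepro2.T5InertSphericalSubquotient Summit.Ventures.HodgeRepro2.T5RecordSatakeCell
  Summit.Ventures.HodgeRepro2.T5SplitPlaceUnitaryGroup Summit.Ventures.HodgeRepro2.T5FinitePlaceNormIndex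
  Summit.Ventures.HodgeRepro2.T5HermitianLocalIsotropyN3 Summit.Ventures.HodgeRepro2.T5FinitePlaceSplitClassification
  Summit.Ventures.HodgeRepro2.T5InertDegreeCompletion Summit.Ventures.HodgeRepro2.T5InertPlaceCompletionCells
  Summit.Ventures.HodgeRepro2.T5RecordSatake Summit.Ventures.HodgeRepro2.T5CartanCellsDistinct
  Summit.Ventures.HodgeRepro2.T5RecordSatakeInert Summit.Ventures.HodgeRepro2.T5InertGlobalPrime
  Summit.Ventures.HodgeRepro2.T5CMFieldSquareDatum Summit.Ventures.HodgeRepro2.T5RecordSatakeDegree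
  Summit.Ventures.HodgeRepro2.T5RecordSatakeDegreeIntrinsic Summit.Ventures.HodgeRepro2.T5RecordSphericalSpectrum

namespace Summit.Ventures.HodgeRepro2.T5RecordSphericalSpectrumIntrinsic

section Matched

variable (K : Type*) [Field K] [NumberField K] [IsCMField K]
variable (v : HeightOneSpectrum (𝓞 (maximalRealSubfield K))) (w : HeightOneSpectrum (𝓞 K))
  [w.asIdeal.LiesOver v.asIdeal]
  [IsDiscreteValuationRing (integralClosure (v.adicCompletionIntegers (maximalRealSubfield K)) (w.adicCompletion K))]
  [Finite (IsLocalRing.ResidueField (integralClosure (v.adicCompletionIntegers (maximalRealSubfield K))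
    (w.adicCompletion K)))]
  [IsFractionRing (integralClosure (v.adicCompletionIntegers (maximalRealSubfield K)) (w.adicCompletion K))
    (w.adicCompletion K)]
variable {θ : maximalRealSubfield K} {y : K}
  (hθ : algebraMap (maximalRealSubfield K) K θ = y ^ 2) (hy : complexConj K y ≠ y)
  (hsq : ¬ IsSquare (algebraMap (maximalRealSubfield K) (v.adicCompletion (maximalRealSubfield K)) θ))
  (he : v.asIdeal.ramificationIdx' w.asIdeal = 1)
  {ϖ : v.adicCompletionIntegers (maximalRealSubfield K)} (hϖ : Irreducible ϖ)
  (hinert : Irreducible (algebraMap (v.adicCompletionIntegers (maximalRealSubfield K)) (w.adicCompletionIntegers K) ϖ))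
variable {r : ℕ} (l : Fin r → 𝓞 K) (k : Type*) [Field k] [CharZero k] [IsAlgClosed k]
  [StarRing (w.adicCompletion K)]
  (hst : ∀ x : w.adicCompletion K, star x = localConj v w hθ.symm (span_pair_eq_top K hy) hsq (complexConj K) x)

include hθ hy hsq he hϖ hinert hst in
/-- File 343's matched-isomorphism theorem with `N(v)` replaced by any `q'` equal to it. -/
theorem forall_nonempty_equiv_inertSphericalQuot_record_of_mulEquiv_of_eq (q' : k)
    (hq' : (Ideal.absNorm v.asIdeal : k) = q') {H : Matrix (Fin 3) (Fin 3) K}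
    (u₀ : (v.adicCompletionIntegers (maximalRealSubfield K))ˣ)
    (Φ : letI := tensorStarRing K v
      ↥(formUnitaryGroup (J3 (algebraMap (v.adicCompletionIntegers (maximalRealSubfield K))
        (w.adicCompletion K) (u₀ : v.adicCompletionIntegers (maximalRealSubfield K))))) ≃*
        ↥(formUnitaryGroup (tensorGram K v H)))
    (hmatch : letI := tensorStarRing K v
      ∀ g, g ∈ hyperspecialSubgroup
          (integralClosure (v.adicCompletionIntegers (maximalRealSubfield K)) (w.adicCompletion K))
          (J3 (algebraMap (v.adicCompletionIntegers (maximalRealSubfield K)) (w.adicCompletion K)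
            (u₀ : v.adicCompletionIntegers (maximalRealSubfield K)))) ↔ Φ g ∈ recordHyperspecial K v l H)
    {V : Type*} [AddCommGroup V] [Module k V]
    (ρ : letI := tensorStarRing K v
      Representation k (↥(formUnitaryGroup (tensorGram K v H))) V) [ρ.IsIrreducible]
    (hK : KFinite ρ (recordHyperspecial K v l H))
    [FiniteDimensional k (invariants ρ (recordHyperspecial K v l H))]
    (hne : invariants ρ (recordHyperspecial K v l H) ≠ ⊥) :
    letI := tensorStarRing K v
    ∃ α : k, α ≠ 0 ∧ Nonempty (ρ.Equiv (comp Φ.symm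
      (inertSphericalQuot (hstar_of_star_eq (localConj v w hθ.symm (span_pair_eq_top K hy) hsq (complexConj K)) hst)
            (algebraMap (v.adicCompletionIntegers (maximalRealSubfield K)) (w.adicCompletion K)
              (u₀ : v.adicCompletionIntegers (maximalRealSubfield K)))
            (star_algebraMap_of_star_eq (localConj v w hθ.symm (span_pair_eq_top K hy) hsq (complexConj K)) hst
              (u₀ : v.adicCompletionIntegers (maximalRealSubfield K)))
            (algebraMap_unit_ne_zero (F := v.adicCompletion (maximalRealSubfield K)) u₀)
            (isInteger_algebraMap (u₀ : v.adicCompletionIntegers (maximalRealSubfield K)))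
            (isInteger_algebraMap_unit_inv u₀)
            (irreducible_uniformiser (map_maximalIdeal_integralClosure_eq_of_irreducible v w hϖ hinert) hϖ)
            (star_algebraMap_of_star_eq (localConj v w hθ.symm (span_pair_eq_top K hy) hsq (complexConj K)) hst ϖ) k
        (α * (q' ^ 2)⁻¹)))) := by
  subst hq'
  exact forall_nonempty_equiv_inertSphericalQuot_record_of_mulEquiv K v w hθ hy hsq he hϖ hinert l k hst u₀ Φ
    hmatch ρ hK hne

end Matched

section StaysPrime

universe uV

variable (K : Type*) [Field K] [NumberField K] [IsCMField K]
variable (v : HeightOneSpectrum (𝓞 (maximalRealSubfield K))) (w : HeightOneSpectrum (𝓞 K))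
  [w.asIdeal.LiesOver v.asIdeal]
variable {θ : maximalRealSubfield K} {y : K}
  (hθ : algebraMap (maximalRealSubfield K) K θ = y ^ 2) (hy : complexConj K y ≠ y)
  (hmap : Ideal.map (algebraMap (𝓞 (maximalRealSubfield K)) (𝓞 K)) v.asIdeal = w.asIdeal)
variable {r : ℕ} (l : Fin r → 𝓞 K) (k : Type*) [Field k] [CharZero k] [IsAlgClosed k]

include hθ hy hmap in
/-- **THE UNRAMIFIED SPECTRUM OF THE RECORD'S OWN PAIR AT EVERY PLACE THAT STAYS PRIME**: for a place `v` of `K⁺` with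
`v 𝓞_K = w`, good for the datum's hermitian unimodular Gram matrix `H`, and any `q'` equal to `N(v)`: there are
`u₀ ∈ 𝒪_{K⁺_v}ˣ`, `Φ : U(J₃(u₀)) ≃* U(1 ⊗ H)` matching the hyperspecial subgroups, and a uniformiser `ϖ'` of `𝒪_{E_v}`
fixed by the star, such that every irreducible `K_v`-finite representation of `U(1 ⊗ H)` with non-zero
finite-dimensional `K_v`-invariants is `≅ (inertSphericalQuot (α q'⁻²)) ∘ Φ⁻¹` for some `α ≠ 0` (file 343 with seat p8's
local hypotheses discharged by file 233's method). -/
theorem exists_mulEquiv_forall_nonempty_equiv_inertSphericalQuot_record_of_staysPrime (q' : k)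
    (hq' : (Ideal.absNorm v.asIdeal : k) = q')
    (hl : Submodule.span (𝓞 (maximalRealSubfield K)) (Set.range l) = ⊤)
    {H : Matrix (Fin 3) (Fin 3) K} (hH : H.IsHermitian) (hdet : IsUnit H.det) (hgood : w ∉ badSet H) :
    letI := tensorStarRing K v
    letI := starRingOfQuadratic (finrank_eq_two K v w hθ hy (not_isSquare_of_staysPrime K v w hθ hy hmap))
      (localConj v w hθ.symm (span_pair_eq_top K hy) (not_isSquare_of_staysPrime K v w hθ hy hmap) (complexConj K))
      (localConj_ne_one v w hθ.symm (span_pair_eq_top K hy) (not_isSquare_of_staysPrime K v w hθ hy hmap)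
        (complexConj K) (complexConj_apply_eq_neg K hθ hy))
    haveI := isDiscreteValuationRing_integralClosure_adicCompletion v w
    haveI := finite_residueField_integralClosure_adicCompletion v w
    haveI : IsFractionRing (integralClosure (v.adicCompletionIntegers (maximalRealSubfield K)) (w.adicCompletion K))
      (w.adicCompletion K) :=
      integralClosure.isFractionRing_of_finite_extension (v.adicCompletion (maximalRealSubfield K))
        (w.adicCompletion K)
    ∃ (u₀ : (v.adicCompletionIntegers (maximalRealSubfield K))ˣ)
      (Φ : ↥(formUnitaryGroup (J3 (algebraMap (v.adicCompletionIntegers (maximalRealSubfield K))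
        (w.adicCompletion K) (u₀ : v.adicCompletionIntegers (maximalRealSubfield K))))) ≃*
        ↥(formUnitaryGroup (tensorGram K v H)))
      (ϖ' : integralClosure (v.adicCompletionIntegers (maximalRealSubfield K)) (w.adicCompletion K))
      (hϖ' : Irreducible ϖ')
      (hs' : star (algebraMap (integralClosure (v.adicCompletionIntegers (maximalRealSubfield K))
        (w.adicCompletion K)) (w.adicCompletion K) ϖ') =
          algebraMap (integralClosure (v.adicCompletionIntegers (maximalRealSubfield K)) (w.adicCompletion K))
            (w.adicCompletion K) ϖ'),
      (∀ g, g ∈ hyperspecialSubgroup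
          (integralClosure (v.adicCompletionIntegers (maximalRealSubfield K)) (w.adicCompletion K))
          (J3 (algebraMap (v.adicCompletionIntegers (maximalRealSubfield K)) (w.adicCompletion K)
            (u₀ : v.adicCompletionIntegers (maximalRealSubfield K)))) ↔ Φ g ∈ recordHyperspecial K v l H) ∧
      ∀ {V : Type uV} [AddCommGroup V] [Module k V]
        (ρ : Representation k (↥(formUnitaryGroup (tensorGram K v H))) V) [ρ.IsIrreducible],
        KFinite ρ (recordHyperspecial K v l H) →
        ∀ [FiniteDimensional k (invariants ρ (recordHyperspecial K v l H))],
        invariants ρ (recordHyperspecial K v l H) ≠ ⊥ →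
        ∃ α : k, α ≠ 0 ∧ Nonempty (ρ.Equiv (comp Φ.symm
          (inertSphericalQuot
            (hstar_of_star_eq (localConj v w hθ.symm (span_pair_eq_top K hy)
              (not_isSquare_of_staysPrime K v w hθ hy hmap) (complexConj K))
              (fun x => by rw [star_p8_eq_star K v w hθ hy (not_isSquare_of_staysPrime K v w hθ hy hmap)]; rfl))
            (algebraMap (v.adicCompletionIntegers (maximalRealSubfield K)) (w.adicCompletion K)
              (u₀ : v.adicCompletionIntegers (maximalRealSubfield K)))
            (star_algebraMap_of_star_eq (localConj v w hθ.symm (span_pair_eq_top K hy)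
              (not_isSquare_of_staysPrime K v w hθ hy hmap) (complexConj K))
              (fun x => by rw [star_p8_eq_star K v w hθ hy (not_isSquare_of_staysPrime K v w hθ hy hmap)]; rfl)
              (u₀ : v.adicCompletionIntegers (maximalRealSubfield K)))
            (algebraMap_unit_ne_zero (F := v.adicCompletion (maximalRealSubfield K)) u₀)
            (isInteger_algebraMap (u₀ : v.adicCompletionIntegers (maximalRealSubfield K)))
            (isInteger_algebraMap_unit_inv u₀) hϖ' hs' k (α * (q' ^ 2)⁻¹)))) := by
  letI := tensorStarRing K v
  letI := starRingOfQuadratic (finrank_eq_two K v w hθ hy (not_isSquare_of_staysPrime K v w hθ hy hmap))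
    (localConj v w hθ.symm (span_pair_eq_top K hy) (not_isSquare_of_staysPrime K v w hθ hy hmap) (complexConj K))
    (localConj_ne_one v w hθ.symm (span_pair_eq_top K hy) (not_isSquare_of_staysPrime K v w hθ hy hmap)
      (complexConj K) (complexConj_apply_eq_neg K hθ hy))
  haveI := isDiscreteValuationRing_integralClosure_adicCompletion v w
  haveI := finite_residueField_integralClosure_adicCompletion v w
  haveI : IsFractionRing (integralClosure (v.adicCompletionIntegers (maximalRealSubfield K)) (w.adicCompletion K))
      (w.adicCompletion K) :=
    integralClosure.isFractionRing_of_finite_extension (v.adicCompletion (maximalRealSubfield K)) (w.adicCompletion K)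
  have hst : ∀ x : w.adicCompletion K, star x = localConj v w hθ.symm (span_pair_eq_top K hy)
      (not_isSquare_of_staysPrime K v w hθ hy hmap) (complexConj K) x := fun x => by
    rw [star_p8_eq_star K v w hθ hy (not_isSquare_of_staysPrime K v w hθ hy hmap)]
    rfl
  refine (exists_irreducible_and_irreducible_algebraMap_of_staysPrime K v w hmap).elim fun ϖ h => ?_
  have key : ∃ (u₀ : (v.adicCompletionIntegers (maximalRealSubfield K))ˣ)
      (Φ : ↥(formUnitaryGroup (J3 (algebraMap (v.adicCompletionIntegers (maximalRealSubfield K))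
        (w.adicCompletion K) (u₀ : v.adicCompletionIntegers (maximalRealSubfield K))))) ≃*
        ↥(formUnitaryGroup (tensorGram K v H))),
      (∀ g, g ∈ hyperspecialSubgroup
          (integralClosure (v.adicCompletionIntegers (maximalRealSubfield K)) (w.adicCompletion K))
          (J3 (algebraMap (v.adicCompletionIntegers (maximalRealSubfield K)) (w.adicCompletion K)
            (u₀ : v.adicCompletionIntegers (maximalRealSubfield K)))) ↔ Φ g ∈ recordHyperspecial K v l H) ∧
      ∀ {V : Type uV} [AddCommGroup V] [Module k V]
        (ρ : Representation k (↥(formUnitaryGroup (tensorGram K v H))) V) [ρ.IsIrreducible],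
        KFinite ρ (recordHyperspecial K v l H) →
        ∀ [FiniteDimensional k (invariants ρ (recordHyperspecial K v l H))],
        invariants ρ (recordHyperspecial K v l H) ≠ ⊥ →
        ∃ α : k, α ≠ 0 ∧ Nonempty (ρ.Equiv (comp Φ.symm
          (inertSphericalQuot (hstar_of_star_eq (localConj v w hθ.symm (span_pair_eq_top K hy) (not_isSquare_of_staysPrime K v w hθ hy hmap) (complexConj K)) (fun x => by rw [star_p8_eq_star K v w hθ hy (not_isSquare_of_staysPrime K v w hθ hy hmap)]; rfl))
            (algebraMap (v.adicCompletionIntegers (maximalRealSubfield K)) (w.adicCompletion K)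
              (u₀ : v.adicCompletionIntegers (maximalRealSubfield K)))
            (star_algebraMap_of_star_eq (localConj v w hθ.symm (span_pair_eq_top K hy) (not_isSquare_of_staysPrime K v w hθ hy hmap) (complexConj K)) (fun x => by rw [star_p8_eq_star K v w hθ hy (not_isSquare_of_staysPrime K v w hθ hy hmap)]; rfl) (u₀ : v.adicCompletionIntegers (maximalRealSubfield K)))
            (algebraMap_unit_ne_zero (F := v.adicCompletion (maximalRealSubfield K)) u₀)
            (isInteger_algebraMap (u₀ : v.adicCompletionIntegers (maximalRealSubfield K)))
            (isInteger_algebraMap_unit_inv u₀)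
            (irreducible_uniformiser (map_maximalIdeal_integralClosure_eq_of_irreducible v w h.1 h.2) h.1)
            (star_algebraMap_of_star_eq (localConj v w hθ.symm (span_pair_eq_top K hy) (not_isSquare_of_staysPrime K v w hθ hy hmap) (complexConj K)) (fun x => by rw [star_p8_eq_star K v w hθ hy (not_isSquare_of_staysPrime K v w hθ hy hmap)]; rfl) ϖ) k
            (α * ((Ideal.absNorm v.asIdeal : k) ^ 2)⁻¹)))) :=
    exists_mulEquiv_forall_nonempty_equiv_inertSphericalQuot_record K v w hθ hy
      (not_isSquare_of_staysPrime K v w hθ hy hmap) (ramificationIdx'_eq_one_of_staysPrime v w hmap) h.1 h.2 l k hl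
      hH hdet hgood
  refine key.elim fun u₀ h1 => h1.elim fun Φ h2 => ?_
  refine ⟨u₀, Φ, _, irreducible_uniformiser (map_maximalIdeal_integralClosure_eq_of_irreducible v w h.1 h.2) h.1,
    star_algebraMap_of_star_eq (R₀ := v.adicCompletionIntegers (maximalRealSubfield K))
      (localConj v w hθ.symm (span_pair_eq_top K hy) (not_isSquare_of_staysPrime K v w hθ hy hmap) (complexConj K))
      hst ϖ, h2.1, ?_⟩
  intro V _ _ ρ _ hK _ hne
  exact forall_nonempty_equiv_inertSphericalQuot_record_of_mulEquiv_of_eq K v w hθ hy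
    (not_isSquare_of_staysPrime K v w hθ hy hmap) (ramificationIdx'_eq_one_of_staysPrime v w hmap) h.1 h.2 l k hst
    q' hq' u₀ Φ h2.1 ρ hK hne

end StaysPrime


end Summit.Ventures.HodgeRepro2.T5RecordSphericalSpectrumIntrinsic
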